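import Summits.CriticalPhenomena.PercolationContinuityZ3.Theorems.PercNearOneGluingAdditiveGluingTwoStepGlueV3pp
import HarnessLib

/-!
# Crux `PercNearOneGluing.AdditiveGluing` (stmt-CriticalPhenomena-4576): the third kernel (II′) of the two-step gluing reduction

Support file (`--supports stmt-CriticalPhenomena-4576`; task png-dp-al5, memos TWOSTEP-GLUE*.md).  No definitions, no named facts, no sorries.
Notation of `…TwoStepGlue.lean` / `…TwoStepGlueV3pp.lean` (glued pair `{a₁,a₂}`, spectator `c`, `θ ≤ τ_{a₁}, τ_{a₂}`, `N = {c↮a₁} ∩ {c↮a₂}`,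
`G_x` = probability that the pair is pivotal for `x ↔ b`, `ROOM₂ = μ(oAᶜ ∩ c↔b ∩ (a₁↔b ∪ a₂↔b)ᶜ)`).

The OTHER one-sided half of the weighted Kozma–Nitzan Theorem 1 in the glued weighting (`twoStep_thm1_half` with the relays exchanged)
bounds the second-step gain by `T_c + φ_c·δ′` and yields CAG(3) from

  (II′)  `μ(N ∩ o↔c)·(μ(a₁↔b ∪ a₂↔b) − τ_c − G_c) ≤ μ(N)·(μ(a₁↔b ∪ a₂↔b) − θ + ROOM₂ − G_o)`,

at a full tie: `φ_c·σ_c ≤ σ_o + ROOM₂` (`σ_x = π − G_x` = Kozma–Nitzan's Lemma-4 slack of `x`, `φ_c = μ(o↔c | c ↮ {a₁,a₂})`): the observer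
inherits at least the fraction `φ_c` of the spectator's Lemma-4 slack.  Numerically 0 violations per pair (task lab t36/t37: 9 000 general-position
tests; all 260 all-bad tied instances).  Together with (V3″) (`twoStep_cag3_of_v3pp`, branch I′) and their ψ-average (★★) (`twoStep_cag3`)
these are three zero-violation sufficient kernels for the three-relay case.
[cite: KozmaNitzan2024, Theorem 1 (pp. 7–8), Lemma 4 (p. 9), Question 7 (p. 36)] [cite: VandenbergHaggstromKahn2005, Thms. 1.3–1.4]
-/

namespace Summit.CriticalPhenomena.PercolationContinuityZ3.Theorems

open MeasureTheory Set Literature.Probability.LatticeModels Literature.Probability.Percolation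

noncomputable section
open Classical

variable {n : ℕ}

/-- **CAG(3) from (II′)** (see the file header).  Hypotheses: `a₁ ≠ a₂`, `a₁ ≠ c`, `θ ≤ τ_{a₁}, τ_{a₂}` and (II′) in product form.
[cite: KozmaNitzan2024, Theorem 1 (pp. 7–8), Lemma 4 (p. 9), Question 7 (p. 36)] -/
theorem twoStep_cag3_of_branch2 (w : Sym2 (Fin n) → unitInterval) (o b a₁ a₂ c : Fin n) (h12 : a₁ ≠ a₂) (h1c : a₁ ≠ c)
    (θ : ℝ) (hθ1 : θ ≤ (prodBernoulli w).real (openConn a₁ b)) (hθ2 : θ ≤ (prodBernoulli w).real (openConn a₂ b))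
    (hB2 : (prodBernoulli w).real ((openConn c a₁)ᶜ ∩ (openConn c a₂)ᶜ ∩ openConn o c) *
        ((prodBernoulli w).real (openConn a₁ b ∪ openConn a₂ b) - (prodBernoulli w).real (openConn c b) -
          (prodBernoulli w).real ((openConn c b)ᶜ ∩ (openConn c a₁ ∪ openConn c a₂) ∩ (openConn a₁ b ∪ openConn a₂ b))) ≤
      (prodBernoulli w).real ((openConn c a₁)ᶜ ∩ (openConn c a₂)ᶜ : Set (BondConfig (Fin n))) *
        ((prodBernoulli w).real (openConn a₁ b ∪ openConn a₂ b) - θ +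
          (prodBernoulli w).real ((openConn o a₁ ∪ openConn o a₂ ∪ openConn o c)ᶜ ∩ openConn c b ∩ (openConn a₁ b ∪ openConn a₂ b)ᶜ) -
          (prodBernoulli w).real ((openConn o b)ᶜ ∩ (openConn o a₁ ∪ openConn o a₂) ∩ (openConn a₁ b ∪ openConn a₂ b)))) :
    (prodBernoulli w).real ((openConn o a₁ ∪ openConn o a₂ ∪ openConn o c) ∩ (openConn o b)ᶜ ∩
        (openConn a₁ b ∪ openConn a₂ b ∪ openConn c b)) ≤
      (prodBernoulli w).real (openConn a₁ b ∪ openConn a₂ b ∪ openConn c b) - θ := by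
  set μ := prodBernoulli w with hμ
  have hm : ∀ s : Set (BondConfig (Fin n)), MeasurableSet s := fun _ => MeasurableSet.of_discrete
  set O₁ : Set (BondConfig (Fin n)) := openConn o a₁ with hO₁
  set O₂ : Set (BondConfig (Fin n)) := openConn o a₂ with hO₂
  set Oc : Set (BondConfig (Fin n)) := openConn o c with hOc
  set Ob : Set (BondConfig (Fin n)) := openConn o b with hOb
  set B₁ : Set (BondConfig (Fin n)) := openConn a₁ b with hB₁
  set B₂ : Set (BondConfig (Fin n)) := openConn a₂ b with hB₂
  set Bc : Set (BondConfig (Fin n)) := openConn c b with hBc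
  set C₁ : Set (BondConfig (Fin n)) := openConn c a₁ with hC₁
  set C₂ : Set (BondConfig (Fin n)) := openConn c a₂ with hC₂
  -- half Theorem 1 in the glued weighting with the relays exchanged: (x, y) = (c, a₁)
  have hH := twoStep_thm1_half (Function.update w s(a₁, a₂) 1) o b c a₁ (Ne.symm h1c)
  have hE1 := twoStep_EF_identity (Function.update w s(a₁, a₂) 1) o b a₁ c
  have hu1 : (openConn o c ∪ openConn o a₁ : Set (BondConfig (Fin n))) = openConn o a₁ ∪ openConn o c :=
    Set.union_comm _ _
  have hsym : ((openConn c a₁)ᶜ : Set (BondConfig (Fin n))) = (openConn a₁ c)ᶜ := by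
    rw [KNPreFKG.openConn_symm c a₁]
  rw [hu1, hsym] at hH
  rw [hE1, twoStep_glue_psic w h12 o c, twoStep_glue_N w h12 c, twoStep_glue_NB12 w h12 b c, twoStep_glue_NBc w h12 b c,
    twoStep_glue_gain w h12 o b c, twoStep_glue_Tc w h12 o b c] at hH
  simp only [← hμ, ← hO₁, ← hO₂, ← hOc, ← hOb, ← hB₁, ← hB₂, ← hBc, ← hC₁, ← hC₂] at hH hB2 ⊢
  have hd1 : μ.real ((O₁ ∪ O₂ ∪ Oc) ∩ Obᶜ ∩ (B₁ ∪ B₂ ∪ Bc)) =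
      μ.real (Obᶜ ∩ (O₁ ∪ O₂) ∩ (B₁ ∪ B₂)) +
        μ.real ((O₁ ∪ O₂ ∪ Oc) ∩ Obᶜ ∩ ((O₁ ∪ O₂) ∩ (B₁ ∪ B₂))ᶜ ∩ (B₁ ∪ B₂ ∪ Bc)) := by
    have h := measureReal_inter_add_sdiff (μ := μ) (s := (O₁ ∪ O₂ ∪ Oc) ∩ Obᶜ ∩ (B₁ ∪ B₂ ∪ Bc))
      (hm ((O₁ ∪ O₂) ∩ (B₁ ∪ B₂)))
    have e1 : (O₁ ∪ O₂ ∪ Oc) ∩ Obᶜ ∩ (B₁ ∪ B₂ ∪ Bc) ∩ ((O₁ ∪ O₂) ∩ (B₁ ∪ B₂)) =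
        Obᶜ ∩ (O₁ ∪ O₂) ∩ (B₁ ∪ B₂) := by
      ext ω; simp only [Set.mem_inter_iff, Set.mem_union, Set.mem_compl_iff]; tauto
    have e2 : ((O₁ ∪ O₂ ∪ Oc) ∩ Obᶜ ∩ (B₁ ∪ B₂ ∪ Bc)) \ ((O₁ ∪ O₂) ∩ (B₁ ∪ B₂)) =
        (O₁ ∪ O₂ ∪ Oc) ∩ Obᶜ ∩ ((O₁ ∪ O₂) ∩ (B₁ ∪ B₂))ᶜ ∩ (B₁ ∪ B₂ ∪ Bc) := by
      ext ω; simp only [Set.mem_sdiff, Set.mem_inter_iff, Set.mem_compl_iff]; tauto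
    rw [e1, e2] at h
    linarith
  have hd2 : μ.real ((O₁ ∪ O₂ ∪ Oc) ∩ Bc ∩ (B₁ ∪ B₂)ᶜ) =
      μ.real (B₁ ∪ B₂ ∪ Bc) - μ.real (B₁ ∪ B₂) - μ.real ((O₁ ∪ O₂ ∪ Oc)ᶜ ∩ Bc ∩ (B₁ ∪ B₂)ᶜ) := by
    have h := measureReal_inter_add_sdiff (μ := μ) (s := B₁ ∪ B₂ ∪ Bc) (hm (B₁ ∪ B₂))
    have e1 : (B₁ ∪ B₂ ∪ Bc) ∩ (B₁ ∪ B₂) = B₁ ∪ B₂ := Set.inter_eq_right.2 Set.subset_union_left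
    have e2 : (B₁ ∪ B₂ ∪ Bc) \ (B₁ ∪ B₂) = Bc ∩ (B₁ ∪ B₂)ᶜ := by
      ext ω; simp only [Set.mem_sdiff, Set.mem_inter_iff, Set.mem_union, Set.mem_compl_iff]; tauto
    rw [e1, e2] at h
    have h' := measureReal_inter_add_sdiff (μ := μ) (s := Bc ∩ (B₁ ∪ B₂)ᶜ) (hm (O₁ ∪ O₂ ∪ Oc))
    have e3 : Bc ∩ (B₁ ∪ B₂)ᶜ ∩ (O₁ ∪ O₂ ∪ Oc) = (O₁ ∪ O₂ ∪ Oc) ∩ Bc ∩ (B₁ ∪ B₂)ᶜ := by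
      ext ω; simp only [Set.mem_inter_iff]; tauto
    have e4 : (Bc ∩ (B₁ ∪ B₂)ᶜ) \ (O₁ ∪ O₂ ∪ Oc) = (O₁ ∪ O₂ ∪ Oc)ᶜ ∩ Bc ∩ (B₁ ∪ B₂)ᶜ := by
      ext ω; simp only [Set.mem_sdiff, Set.mem_inter_iff, Set.mem_compl_iff]; tauto
    rw [e3, e4] at h'
    linarith
  have hd4 : μ.real (C₁ᶜ ∩ C₂ᶜ ∩ (B₁ ∪ B₂)) - μ.real (C₁ᶜ ∩ C₂ᶜ ∩ Bc) =
      μ.real (B₁ ∪ B₂) - μ.real Bc - μ.real (Bcᶜ ∩ (C₁ ∪ C₂) ∩ (B₁ ∪ B₂)) := by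
    have h1 := measureReal_inter_add_sdiff (μ := μ) (s := B₁ ∪ B₂) (hm (C₁ᶜ ∩ C₂ᶜ))
    have h2 := measureReal_inter_add_sdiff (μ := μ) (s := Bc) (hm (C₁ᶜ ∩ C₂ᶜ))
    have h3 := measureReal_inter_add_sdiff (μ := μ) (s := (B₁ ∪ B₂) \ (C₁ᶜ ∩ C₂ᶜ)) (hm Bc)
    have e1 : (B₁ ∪ B₂) ∩ (C₁ᶜ ∩ C₂ᶜ) = C₁ᶜ ∩ C₂ᶜ ∩ (B₁ ∪ B₂) := Set.inter_comm _ _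
    have e2 : Bc ∩ (C₁ᶜ ∩ C₂ᶜ) = C₁ᶜ ∩ C₂ᶜ ∩ Bc := Set.inter_comm _ _
    -- on `Nᶜ` (c joined to the pair), `c↔b ⊆ a₁↔b ∪ a₂↔b`
    have e3 : ((B₁ ∪ B₂) \ (C₁ᶜ ∩ C₂ᶜ)) ∩ Bc = Bc \ (C₁ᶜ ∩ C₂ᶜ) := by
      ext ω
      simp only [Set.mem_inter_iff, Set.mem_sdiff, Set.mem_union, Set.mem_compl_iff, hB₁, hB₂, hBc, hC₁, hC₂, openConn,
        Set.mem_setOf_eq, not_and, not_not]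
      constructor
      · rintro ⟨⟨_, hN⟩, hcb⟩; exact ⟨hcb, hN⟩
      · rintro ⟨hcb, hN⟩
        refine ⟨⟨?_, hN⟩, hcb⟩
        by_cases h1 : (openGraph ω).Reachable c a₁
        · exact Or.inl (h1.symm.trans hcb)
        · exact Or.inr ((hN h1).symm.trans hcb)
    have e4 : ((B₁ ∪ B₂) \ (C₁ᶜ ∩ C₂ᶜ)) \ Bc = Bcᶜ ∩ (C₁ ∪ C₂) ∩ (B₁ ∪ B₂) := by
      ext ω; simp only [Set.mem_sdiff, Set.mem_inter_iff, Set.mem_union, Set.mem_compl_iff]; tauto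
    rw [e1] at h1
    rw [e2] at h2
    rw [e3, e4] at h3
    linarith
  have hL4 := knLemma4_pair w o a₁ a₂ b
  simp only [← hμ, ← hO₁, ← hO₂, ← hOb, ← hB₁, ← hB₂] at hL4
  have hmin : θ ≤ min (μ.real B₁) (μ.real B₂) := le_min hθ1 hθ2
  have hmono : μ.real (B₁ ∪ B₂) ≤ μ.real (B₁ ∪ B₂ ∪ Bc) := measureReal_mono Set.subset_union_left (measure_ne_top _ _)
  -- the glued gain event lies in `N`
  have hGGsub : (O₁ ∪ O₂ ∪ Oc) ∩ Obᶜ ∩ ((O₁ ∪ O₂) ∩ (B₁ ∪ B₂))ᶜ ∩ (B₁ ∪ B₂ ∪ Bc) ⊆ C₁ᶜ ∩ C₂ᶜ := by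
    intro ω hω
    rcases hω with ⟨⟨⟨hO, -⟩, hnX⟩, hB⟩
    simp only [Set.mem_union, Set.mem_inter_iff, Set.mem_compl_iff, not_and, not_or] at hO hB hnX ⊢
    have hnb : (ω ∈ O₁ ∨ ω ∈ O₂) → ω ∉ B₁ ∧ ω ∉ B₂ := fun h => hnX h
    constructor
    · intro hc1
      have hO12 : ω ∈ O₁ ∨ ω ∈ O₂ := by
        rcases hO with h | hc
        · exact h
        · exact Or.inl (SimpleGraph.Reachable.trans hc hc1)
      have hnb' := hnb hO12
      rcases hB with (hb1 | hb2) | hbc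
      · exact hnb'.1 hb1
      · exact hnb'.2 hb2
      · exact hnb'.1 (SimpleGraph.Reachable.trans (SimpleGraph.Reachable.symm hc1) hbc)
    · intro hc2
      have hO12 : ω ∈ O₁ ∨ ω ∈ O₂ := by
        rcases hO with h | hc
        · exact h
        · exact Or.inr (SimpleGraph.Reachable.trans hc hc2)
      have hnb' := hnb hO12
      rcases hB with (hb1 | hb2) | hbc
      · exact hnb'.1 hb1
      · exact hnb'.2 hb2
      · exact hnb'.2 (SimpleGraph.Reachable.trans (SimpleGraph.Reachable.symm hc2) hbc)
  have hGGle : μ.real ((O₁ ∪ O₂ ∪ Oc) ∩ Obᶜ ∩ ((O₁ ∪ O₂) ∩ (B₁ ∪ B₂))ᶜ ∩ (B₁ ∪ B₂ ∪ Bc)) ≤ μ.real (C₁ᶜ ∩ C₂ᶜ) :=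
    measureReal_mono hGGsub (measure_ne_top _ _)
  rw [hd1]
  by_cases hN0 : μ.real (C₁ᶜ ∩ C₂ᶜ) = 0
  · have hGG0 : μ.real ((O₁ ∪ O₂ ∪ Oc) ∩ Obᶜ ∩ ((O₁ ∪ O₂) ∩ (B₁ ∪ B₂))ᶜ ∩ (B₁ ∪ B₂ ∪ Bc)) = 0 :=
      le_antisymm (hN0 ▸ hGGle) measureReal_nonneg
    rw [hGG0]
    linarith
  · have hNpos : 0 < μ.real (C₁ᶜ ∩ C₂ᶜ) := lt_of_le_of_ne measureReal_nonneg (Ne.symm hN0)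
    rw [hd2] at hH
    have hH2 : μ.real (C₁ᶜ ∩ C₂ᶜ ∩ Oc) * (μ.real (C₁ᶜ ∩ C₂ᶜ ∩ Bc) - μ.real (C₁ᶜ ∩ C₂ᶜ ∩ (B₁ ∪ B₂))) =
        -(μ.real (C₁ᶜ ∩ C₂ᶜ ∩ Oc) *
          (μ.real (B₁ ∪ B₂) - μ.real Bc - μ.real (Bcᶜ ∩ (C₁ ∪ C₂) ∩ (B₁ ∪ B₂)))) := by
      rw [← hd4]; ring
    rw [hH2] at hH
    have key : μ.real (C₁ᶜ ∩ C₂ᶜ) *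
        (μ.real (Obᶜ ∩ (O₁ ∪ O₂) ∩ (B₁ ∪ B₂)) +
          μ.real ((O₁ ∪ O₂ ∪ Oc) ∩ Obᶜ ∩ ((O₁ ∪ O₂) ∩ (B₁ ∪ B₂))ᶜ ∩ (B₁ ∪ B₂ ∪ Bc)) + θ -
          μ.real (B₁ ∪ B₂ ∪ Bc)) ≤ 0 := by
      nlinarith [hH, hB2]
    have key2 : μ.real (Obᶜ ∩ (O₁ ∪ O₂) ∩ (B₁ ∪ B₂)) +
        μ.real ((O₁ ∪ O₂ ∪ Oc) ∩ Obᶜ ∩ ((O₁ ∪ O₂) ∩ (B₁ ∪ B₂))ᶜ ∩ (B₁ ∪ B₂ ∪ Bc)) + θ -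
        μ.real (B₁ ∪ B₂ ∪ Bc) ≤ 0 := by
      by_contra hc
      have hc' : 0 < μ.real (Obᶜ ∩ (O₁ ∪ O₂) ∩ (B₁ ∪ B₂)) +
          μ.real ((O₁ ∪ O₂ ∪ Oc) ∩ Obᶜ ∩ ((O₁ ∪ O₂) ∩ (B₁ ∪ B₂))ᶜ ∩ (B₁ ∪ B₂ ∪ Bc)) + θ -
          μ.real (B₁ ∪ B₂ ∪ Bc) := lt_of_not_ge hc
      have := mul_pos hNpos hc'
      linarith
    linarith

/-- **E-form corollary of (II′)**: for three relays with the pair `{a₁,a₂}` glued and spectator `a₃`, with `θ = 1 − t ≤ τ_{a₁}, τ_{a₂}`,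
hypothesis (II′) gives the three-relay conclusion `μ((o↔a₁ ∪ o↔a₂ ∪ o↔a₃) \ o↔b) ≤ t` of `stub_threeRelaysFullTieAllBad_pl`.
[cite: KozmaNitzan2024, Theorem 1 (pp. 7–8), Question 7 (p. 36)] -/
theorem twoStep_threeRelays_eform_of_branch2 (w : Sym2 (Fin n) → unitInterval) (o b a₁ a₂ a₃ : Fin n) (t : ℝ)
    (h12 : a₁ ≠ a₂) (h13 : a₁ ≠ a₃)
    (ht1 : 1 - t ≤ (prodBernoulli w).real (openConn a₁ b)) (ht2 : 1 - t ≤ (prodBernoulli w).real (openConn a₂ b))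
    (hB2 : (prodBernoulli w).real ((openConn a₃ a₁)ᶜ ∩ (openConn a₃ a₂)ᶜ ∩ openConn o a₃) *
        ((prodBernoulli w).real (openConn a₁ b ∪ openConn a₂ b) - (prodBernoulli w).real (openConn a₃ b) -
          (prodBernoulli w).real ((openConn a₃ b)ᶜ ∩ (openConn a₃ a₁ ∪ openConn a₃ a₂) ∩ (openConn a₁ b ∪ openConn a₂ b))) ≤
      (prodBernoulli w).real ((openConn a₃ a₁)ᶜ ∩ (openConn a₃ a₂)ᶜ : Set (BondConfig (Fin n))) *
        ((prodBernoulli w).real (openConn a₁ b ∪ openConn a₂ b) - (1 - t) +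
          (prodBernoulli w).real ((openConn o a₁ ∪ openConn o a₂ ∪ openConn o a₃)ᶜ ∩ openConn a₃ b ∩
            (openConn a₁ b ∪ openConn a₂ b)ᶜ) -
          (prodBernoulli w).real ((openConn o b)ᶜ ∩ (openConn o a₁ ∪ openConn o a₂) ∩ (openConn a₁ b ∪ openConn a₂ b)))) :
    (prodBernoulli w).real ((openConn o a₁ ∪ openConn o a₂ ∪ openConn o a₃) \ openConn o b) ≤ t := by
  have hcag := twoStep_cag3_of_branch2 w o b a₁ a₂ a₃ h12 h13 (1 - t) ht1 ht2 hB2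
  have hm : ∀ s : Set (BondConfig (Fin n)), MeasurableSet s := fun _ => MeasurableSet.of_discrete
  set μ := prodBernoulli w with hμ
  set oA : Set (BondConfig (Fin n)) := openConn o a₁ ∪ openConn o a₂ ∪ openConn o a₃ with hoA
  set Ab : Set (BondConfig (Fin n)) := openConn a₁ b ∪ openConn a₂ b ∪ openConn a₃ b with hAb
  have h1 := measureReal_inter_add_sdiff (μ := μ) (s := oA \ openConn o b) (hm Ab)
  have e1 : (oA \ openConn o b) ∩ Ab = oA ∩ (openConn o b)ᶜ ∩ Ab := by rw [Set.sdiff_eq]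
  have h2 : μ.real ((oA \ openConn o b) \ Ab) ≤ μ.real Abᶜ := measureReal_mono (fun ω hω => hω.2) (measure_ne_top _ _)
  have h3 : μ.real Abᶜ = 1 - μ.real Ab := probReal_compl_eq_one_sub (hm _)
  rw [e1] at h1
  linarith

/-- **E-form corollary of (V3″)** (`twoStep_cag3_of_v3pp` of `…TwoStepGlueV3pp.lean`, announced there but not written): for three relays with
the pair `{a₁,a₂}` glued and spectator `a₃`, with `θ = 1 − t ≤ τ_{a₁}, τ_{a₂}`, hypothesis (V3″) gives `μ((o↔a₁ ∪ o↔a₂ ∪ o↔a₃) \ o↔b) ≤ t`.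
[cite: KozmaNitzan2024, Theorem 1 (pp. 7–8), Question 7 (p. 36)] -/
theorem twoStep_threeRelays_eform_of_v3pp (w : Sym2 (Fin n) → unitInterval) (o b a₁ a₂ a₃ : Fin n) (t : ℝ)
    (h12 : a₁ ≠ a₂) (h13 : a₁ ≠ a₃)
    (ht1 : 1 - t ≤ (prodBernoulli w).real (openConn a₁ b)) (ht2 : 1 - t ≤ (prodBernoulli w).real (openConn a₂ b))
    (hV : (prodBernoulli w).real ((openConn a₃ a₁)ᶜ ∩ (openConn a₃ a₂)ᶜ : Set (BondConfig (Fin n))) *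
        ((prodBernoulli w).real ((openConn o b)ᶜ ∩ (openConn o a₁ ∪ openConn o a₂) ∩ (openConn a₁ b ∪ openConn a₂ b)) -
          (prodBernoulli w).real ((openConn a₃ b)ᶜ ∩ (openConn a₃ a₁ ∪ openConn a₃ a₂) ∩ (openConn a₁ b ∪ openConn a₂ b)) -
          (prodBernoulli w).real ((openConn o a₁ ∪ openConn o a₂ ∪ openConn o a₃)ᶜ ∩ (openConn a₁ b ∪ openConn a₂ b) ∩
            (openConn a₃ b)ᶜ ∩ ((openConn a₃ a₁)ᶜ ∩ (openConn a₃ a₂)ᶜ)) -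
          ((prodBernoulli w).real (openConn a₃ b) - (1 - t))) ≤
      (prodBernoulli w).real ((openConn a₃ a₁)ᶜ ∩ (openConn a₃ a₂)ᶜ ∩ (openConn o a₁ ∪ openConn o a₂)) *
        ((prodBernoulli w).real (openConn a₁ b ∪ openConn a₂ b) - (prodBernoulli w).real (openConn a₃ b) -
          (prodBernoulli w).real ((openConn a₃ b)ᶜ ∩ (openConn a₃ a₁ ∪ openConn a₃ a₂) ∩ (openConn a₁ b ∪ openConn a₂ b)))) :
    (prodBernoulli w).real ((openConn o a₁ ∪ openConn o a₂ ∪ openConn o a₃) \ openConn o b) ≤ t := by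
  have hcag := twoStep_cag3_of_v3pp w o b a₁ a₂ a₃ h12 h13 (1 - t) ht1 ht2 hV
  have hm : ∀ s : Set (BondConfig (Fin n)), MeasurableSet s := fun _ => MeasurableSet.of_discrete
  set μ := prodBernoulli w with hμ
  set oA : Set (BondConfig (Fin n)) := openConn o a₁ ∪ openConn o a₂ ∪ openConn o a₃ with hoA
  set Ab : Set (BondConfig (Fin n)) := openConn a₁ b ∪ openConn a₂ b ∪ openConn a₃ b with hAb
  have h1 := measureReal_inter_add_sdiff (μ := μ) (s := oA \ openConn o b) (hm Ab)
  have e1 : (oA \ openConn o b) ∩ Ab = oA ∩ (openConn o b)ᶜ ∩ Ab := by rw [Set.sdiff_eq]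
  have h2 : μ.real ((oA \ openConn o b) \ Ab) ≤ μ.real Abᶜ := measureReal_mono (fun ω hω => hω.2) (measure_ne_top _ _)
  have h3 : μ.real Abᶜ = 1 - μ.real Ab := probReal_compl_eq_one_sub (hm _)
  rw [e1] at h1
  linarith

end

end Summit.CriticalPhenomena.PercolationContinuityZ3.Theorems
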